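/-
Copyright: public-audit package `pub-balaban` (b2b-balaban), seat pv28-g13. Released under Apache 2.0 like Mathlib.
-/
import Literature.MathematicalPhysics.QuantumFieldTheory.Balaban1983to89.T4WilsonLinkAffine

/-!
# T4 — caveat (ALIGN), first item: SCALAR BOUNDS on the explicit Wilson staple datum, and the small-field Wilson
# corollary of the one-link gnomonic plug

* Value = kernel certificate (quaternion algebra on the cell's tori + one application of the parent plug BY NAME);
  NOT summit progress; NOT continuum; NOT Clay.  0 [cite], 0 [model]: everything here is [folklore]; NO printed
  sentence is asserted and nothing internally minted is cited (ABSOLUTE RULE).  Cell row T4-O3.E-iii-b-G7 (BL-window),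
  lineage pv28, record `t4/T4-EST-O3Eiiib-G7.md` §2decies/§2undecies; this leaf types the located item (ALIGN-0) of
  GAPS G-pv28g13-2.
* WHAT IT ADDS to `T4WilsonLinkAffine` (which made the Wilson exponent `U ↦ c·wilsonAction w U` one-link
  quaternion-affine through every bond `b` with the explicit datum `a = wilsonDatum c w u b = Σ_p (−c·w)·plaqDatum u b p`):
  (1) THE ALIGNED PART IS A PLAQUETTE TRACE SUM: `Re(su2Quat g · a) = −(c·w) · Σ_{p ∋ b} reTr((u with u(b) := g)(∂p))`
      (`re_su2Quat_mul_wilsonDatum`; at `g = u b` the staple-closed traces of `u` itself, `…_self`);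
  (2) SIZE: `‖plaqDatum u b p‖ = 1` on `∂p ∋ b` (unit quaternions), `‖a‖ ≤ |c·w|·N_b` (`norm_wilsonDatum_le`,
      `N_b = letterCount b = 2(d−1)`);
  (3) SMALL FIELD ⇒ ALIGNMENT: if every plaquette through `b` of the relevant field has `reTr ≥ 1 − ε` then the aligned
      part is `≥ β·w·N_b·(1 − ε) ≥ 0` and the transverse part obeys `‖a‖² − Re(a·q)² ≤ (β·w·N_b·√(2ε))²`
      (`wilson_aligned_ge`, `wilson_transverse_le`; Gibbs normalisation `c = −β`, `β, w ≥ 0`, `0 ≤ ε ≤ 1`);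
  (4) LIPSCHITZ IN THE STAPLE LINKS: `‖plaqDatum u b p − plaqDatum u' b p‖ ≤ 3δ` and
      `‖wilsonDatum c w u b − wilsonDatum c w u' b‖ ≤ |c·w|·N_b·3δ` whenever `‖su2Quat(u b') − su2Quat(u' b')‖ ≤ δ` for
      all bonds `b'` (`norm_plaqDatum_sub_le`, `norm_wilsonDatum_sub_le`; with the conversion
      `‖su2Quat U − su2Quat V‖² = 2(1 − reTr(U·V⁻¹))`, `norm_su2Quat_sub_sq`);
  (5) THE COROLLARY `mem_respDom_of_wilson_smallField`: the parent plug
      `T4GnomonicWilsonHessian.mem_respDom_of_gnoChart_linkAffine'` for `h = fun U => −β * wilsonAction w U` with its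
      binders `haff₀ haff₁ hA₀ hA₁ hb₀ hB₀ hB₁ hmu₀ hmu₁ hgapN` REPLACED by: `0 ≤ β`, `0 ≤ w`, `0 ≤ ε ≤ 1`, the two
      plaquette conditions `reTr ≥ 1 − ε` through `b` (at `u₀`, and at `u` with `u(b)` reset to `u₀(b)`), the link
      closeness `δ`, ONE modulus inequality `mu ≤ gnoMu (N·β·w·(1−ε)) (N·β·w·√(2ε)) ρ` (`N = 2(d−1)`) and the budget
      `β·w·N·3δ·(1+ρ+ρ²) ≤ b_H·dev u`; conclusion character-identical to the plug's.

## Honest caveats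

* (USE) Nothing here says that Bałaban's small-field region supplies `ε`, `δ` (uniformly in the step), nor that the
  consumer's `b_H·dev u` dominates the staple-link distance — that is the Bałaban-side / consumer-side content of
  (ALIGN) (EST; GAPS G-pv28g13-2) and stays open.  (N1) one-link fibres only; (RANK) `SU(2)` only; (INS) the
  measurability / integrability / insert binders of the plug are carried verbatim; (k ≥ 1) the exponent is the k = 0
  Wilson action — Bałaban's effective actions after RG steps are not of this form.
-/

noncomputable section

open scoped Quaternion

namespace Literature.MathematicalPhysics.QuantumFieldTheory.Balaban1983to89.T4WilsonDatumBounds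

open Literature.MathematicalPhysics.QuantumLattice (su2Quat norm_su2Quat)
open Literature.Probability.Distributions (coordGradient)
open Function (updateFinset)
open T4HaarSU2Translate (su2Quat_mul su2Quat_one)
open T4CubePoincare (cube)
open T4CubeChartGnomonic (SU2 gnoFibreChart windowDensity)
open T4CubeConvexExtension (gnoKappa)
open T4GnomonicWilsonHessian (LinkAffine gnoMu gnoMu_mono_left imVec imVec_dotProduct_self reTr_eq_re_su2Quat
  mem_respDom_of_gnoChart_linkAffine')
open T4WilsonLinkAffine

variable {P : Params} {j : ℕ}

/-! ## §1  Unit-quaternion bookkeeping -/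

/-- Inverting both links does not change the quaternion distance (`su2Quat U⁻¹ = star (su2Quat U)`). [folklore] -/
theorem norm_su2Quat_inv_sub (U V : SU2) : ‖su2Quat U⁻¹ - su2Quat V⁻¹‖ = ‖su2Quat U - su2Quat V‖ := by
  rw [su2Quat_inv, su2Quat_inv, ← star_sub, Quaternion.norm_star]

/-- Products of unit quaternions are 1-Lipschitz in each factor. [folklore] -/
theorem norm_mul_sub_mul_le_of_norm_eq_one {x y x' y' : ℍ} (hy : ‖y‖ = 1) (hx' : ‖x'‖ = 1) :
    ‖x * y - x' * y'‖ ≤ ‖x - x'‖ + ‖y - y'‖ := by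
  have h : x * y - x' * y' = (x - x') * y + x' * (y - y') := by noncomm_ring
  rw [h]
  refine (norm_add_le _ _).trans (le_of_eq ?_)
  rw [norm_mul, norm_mul, hy, hx', mul_one, one_mul]

/-- The same for three factors. [folklore] -/
theorem norm_mul₃_sub_le_of_norm_eq_one {x y z x' y' z' : ℍ} (hy : ‖y‖ = 1) (hz : ‖z‖ = 1) (hx' : ‖x'‖ = 1)
    (hy' : ‖y'‖ = 1) : ‖x * y * z - x' * y' * z'‖ ≤ ‖x - x'‖ + ‖y - y'‖ + ‖z - z'‖ := by
  have h1 : ‖x * y * z - x' * y' * z'‖ ≤ ‖x * y - x' * y'‖ + ‖z - z'‖ :=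
    norm_mul_sub_mul_le_of_norm_eq_one hz (by rw [norm_mul, hx', hy', one_mul])
  linarith [norm_mul_sub_mul_le_of_norm_eq_one (x := x) (y := y) (x' := x') (y' := y') hy hx']

/-- `Re(q)² ≤ ‖q‖²` (the imaginary part has non-negative square length). [folklore] -/
theorem re_sq_le_norm_sq (q : ℍ) : q.re ^ 2 ≤ ‖q‖ ^ 2 := by
  have h1 := imVec_dotProduct_self q
  have h2 : (0 : ℝ) ≤ imVec q ⬝ᵥ imVec q := by simpa using dotProduct_star_self_nonneg (imVec q)
  linarith

/-- `|Re(q · a)| ≤ ‖a‖` for a unit quaternion `q = su2Quat g`. [folklore] -/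
theorem abs_re_su2Quat_mul_le (g : SU2) (a : ℍ) : |(su2Quat g * a).re| ≤ ‖a‖ := by
  have hn : ‖su2Quat g * a‖ = ‖a‖ := by rw [norm_mul, norm_su2Quat, one_mul]
  rw [← hn]
  exact abs_le_of_sq_le_sq (by simpa using re_sq_le_norm_sq (su2Quat g * a)) (norm_nonneg _)

/-- The quaternion distance of two group elements in trace currency:
`‖su2Quat U − su2Quat V‖² = 2·(1 − reTr(U·V⁻¹))`. [folklore] -/
theorem norm_su2Quat_sub_sq (U V : SU2) : ‖su2Quat U - su2Quat V‖ ^ 2 = 2 * (1 - reTr (U * V⁻¹)) := by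
  rw [reTr_eq_re_su2Quat, su2Quat_mul, su2Quat_inv, sq, ← Quaternion.normSq_eq_norm_mul_self,
    Quaternion.normSq_def']
  have hU : (su2Quat U).re ^ 2 + (su2Quat U).imI ^ 2 + (su2Quat U).imJ ^ 2 + (su2Quat U).imK ^ 2 = 1 := by
    rw [← Quaternion.normSq_def', Quaternion.normSq_eq_norm_mul_self, norm_su2Quat, mul_one]
  have hV : (su2Quat V).re ^ 2 + (su2Quat V).imI ^ 2 + (su2Quat V).imJ ^ 2 + (su2Quat V).imK ^ 2 = 1 := by
    rw [← Quaternion.normSq_def', Quaternion.normSq_eq_norm_mul_self, norm_su2Quat, mul_one]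
  simp only [Quaternion.re_sub, Quaternion.imI_sub, Quaternion.imJ_sub, Quaternion.imK_sub, Quaternion.re_mul,
    Quaternion.re_star, Quaternion.imI_star, Quaternion.imJ_star, Quaternion.imK_star]
  nlinarith [hU, hV]

/-! ## §2  The size of the staple datum -/

section Datum

variable [DecidableEq (PBond P j)]

/-- Every staple is a product of unit quaternions: `‖plaqDatum u b p‖ = 1` if `b ∈ ∂p`, `0` otherwise. [folklore] -/
theorem norm_plaqDatum (u : GaugeField P j SU2) (b : PBond P j) (p : Plaq P j) :
    ‖plaqDatum u b p‖ = if IsLetter b p then 1 else 0 := by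
  by_cases hL : IsLetter b p
  · rw [if_pos hL]
    unfold plaqDatum
    split_ifs with h1 h2 h3 h4
    · exact norm_su2Quat _
    · rw [norm_mul, norm_su2Quat, norm_su2Quat, mul_one]
    · rw [Quaternion.norm_star, norm_mul, norm_su2Quat, norm_su2Quat, mul_one]
    · rw [Quaternion.norm_star, norm_su2Quat]
    · exact absurd hL (by simp only [IsLetter, not_or]; exact ⟨h1, h2, h3, h4⟩)
  · rw [if_neg hL, plaqDatum_of_not_isLetter hL, norm_zero]

/-- Hence `‖wilsonDatum c w u b‖ ≤ |c·w| · N_b`. [folklore] -/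
theorem norm_wilsonDatum_le (c w : ℝ) (u : GaugeField P j SU2) (b : PBond P j) :
    ‖wilsonDatum c w u b‖ ≤ |c * w| * (letterCount b : ℝ) := by
  unfold wilsonDatum
  refine (norm_sum_le _ _).trans (le_of_eq ?_)
  have h : ∀ p : Plaq P j, ‖(-(c * w)) • plaqDatum u b p‖ = |c * w| * (if IsLetter b p then 1 else 0) := by
    intro p
    rw [norm_smul, Real.norm_eq_abs, abs_neg, norm_plaqDatum]
  simp_rw [h, ← Finset.mul_sum, Finset.sum_boole, letterCount]

/-! ## §3  The aligned part of the datum is a plaquette trace sum -/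

/-- `Σ_{p ∋ b} reTr u(∂p)`: the sum of the traces of the `N_b` plaquettes through `b`. [folklore] -/
def stapleTrace (u : GaugeField P j SU2) (b : PBond P j) : ℝ :=
  ∑ p ∈ Finset.univ.filter (fun p : Plaq P j => IsLetter b p), reTr (GaugeField.plaqHol u p)

/-- The one-plaquette affine identity of `T4WilsonLinkAffine`, unpacked. [folklore] -/
theorem reTr_plaqHol_update (u : GaugeField P j SU2) (b : PBond P j) (p : Plaq P j) (g : SU2) :
    reTr (GaugeField.plaqHol (Function.update u b g) p) = plaqKappa u b p + (su2Quat g * plaqDatum u b p).re :=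
  linkAffine_reTr_plaqHol u b p g

/-- For `b ∈ ∂p`: `Re(su2Quat g · plaqDatum u b p)` IS the trace of the plaquette with `u(b)` replaced by `g`.
[folklore] -/
theorem re_su2Quat_mul_plaqDatum {u : GaugeField P j SU2} {b : PBond P j} {p : Plaq P j} (hL : IsLetter b p)
    (g : SU2) : (su2Quat g * plaqDatum u b p).re = reTr (GaugeField.plaqHol (Function.update u b g) p) := by
  rw [reTr_plaqHol_update, plaqKappa, if_pos hL, zero_add]

/-- For `b ∉ ∂p` the plaquette does not see the link. [folklore] -/
theorem reTr_plaqHol_update_of_not_isLetter {u : GaugeField P j SU2} {b : PBond P j} {p : Plaq P j}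
    (hL : ¬ IsLetter b p) (g : SU2) :
    reTr (GaugeField.plaqHol (Function.update u b g) p) = reTr (GaugeField.plaqHol u p) := by
  rw [reTr_plaqHol_update, plaqKappa, if_neg hL, plaqDatum_of_not_isLetter hL, mul_zero, Quaternion.re_zero,
    add_zero]

/-- **THE ALIGNED PART OF THE WILSON DATUM IS A PLAQUETTE TRACE SUM**:
`Re(su2Quat g · wilsonDatum c w u b) = −(c·w) · Σ_{p ∋ b} reTr((u with u(b) := g)(∂p))`. [folklore] -/
theorem re_su2Quat_mul_wilsonDatum (c w : ℝ) (u : GaugeField P j SU2) (b : PBond P j) (g : SU2) :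
    (su2Quat g * wilsonDatum c w u b).re = -(c * w) * stapleTrace (Function.update u b g) b := by
  have H := linkAffine_wilsonAction c w u b g
  dsimp only at H
  have e : (su2Quat g * wilsonDatum c w u b).re = c * wilsonAction w (Function.update u b g) - wilsonKappa c w u b := by
    linarith
  rw [e, wilsonAction, wilsonKappa, stapleTrace, Finset.mul_sum, Finset.mul_sum, Finset.sum_filter,
    ← Finset.sum_sub_distrib]
  refine Finset.sum_congr rfl fun p _ => ?_
  by_cases hL : IsLetter b p
  · rw [if_pos hL, plaqKappa, if_pos hL]
    ring
  · rw [if_neg hL, reTr_plaqHol_update_of_not_isLetter hL, plaqKappa, if_neg hL]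
    ring

/-- … in particular at `g = u b` (the datum read against its own base link): the staple-closed traces of `u`.
[folklore] -/
theorem re_su2Quat_mul_wilsonDatum_self (c w : ℝ) (u : GaugeField P j SU2) (b : PBond P j) :
    (su2Quat (u b) * wilsonDatum c w u b).re = -(c * w) * stapleTrace u b := by
  rw [re_su2Quat_mul_wilsonDatum, Function.update_eq_self]

/-- The same in the plug's orientation `Re(a · q)`. [folklore] -/
theorem re_wilsonDatum_mul_su2Quat (c w : ℝ) (u : GaugeField P j SU2) (b : PBond P j) (g : SU2) :
    (wilsonDatum c w u b * su2Quat g).re = -(c * w) * stapleTrace (Function.update u b g) b := by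
  rw [← re_su2Quat_mul_wilsonDatum]
  simp only [Quaternion.re_mul]
  ring

/-! ## §4  Small plaquettes through `b` ⇒ an aligned datum with small transverse part -/

/-- Trace sum upper bound: `Σ_{p∋b} reTr u(∂p) ≤ N_b` (`reTr ≤ 1`). [folklore] -/
theorem stapleTrace_le (u : GaugeField P j SU2) (b : PBond P j) : stapleTrace u b ≤ (letterCount b : ℝ) := by
  unfold stapleTrace letterCount
  have h := Finset.sum_le_card_nsmul (Finset.univ.filter (fun p : Plaq P j => IsLetter b p))
    (fun p => reTr (GaugeField.plaqHol u p)) 1 (fun p _ => GaugeGroup.reTr_le_one _)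
  rwa [nsmul_eq_mul, mul_one] at h

/-- Trace sum lower bound: `N_b·(1 − ε) ≤ Σ_{p∋b} reTr u(∂p)` under `reTr u(∂p) ≥ 1 − ε` on `∂p ∋ b`. [folklore] -/
theorem le_stapleTrace {u : GaugeField P j SU2} {b : PBond P j} {ε : ℝ}
    (hsf : ∀ p, IsLetter b p → 1 - ε ≤ reTr (GaugeField.plaqHol u p)) :
    (letterCount b : ℝ) * (1 - ε) ≤ stapleTrace u b := by
  unfold stapleTrace letterCount
  have h := Finset.card_nsmul_le_sum (Finset.univ.filter (fun p : Plaq P j => IsLetter b p))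
    (fun p => reTr (GaugeField.plaqHol u p)) (1 - ε) (fun p hp => hsf p (Finset.mem_filter.1 hp).2)
  rwa [nsmul_eq_mul] at h

/-- **ALIGNMENT** (Gibbs normalisation `c = −β`): if every plaquette through `b` of `u with u(b) := g` has
`reTr ≥ 1 − ε`, then `Re(wilsonDatum (−β) w u b · su2Quat g) ≥ β·w·N_b·(1 − ε)`. [folklore] -/
theorem wilson_aligned_ge {β w ε : ℝ} (hβw : 0 ≤ β * w) {u : GaugeField P j SU2} {b : PBond P j} {g : SU2}
    (hsf : ∀ p, IsLetter b p → 1 - ε ≤ reTr (GaugeField.plaqHol (Function.update u b g) p)) :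
    β * w * ((letterCount b : ℝ) * (1 - ε)) ≤ (wilsonDatum (-β) w u b * su2Quat g).re := by
  rw [re_wilsonDatum_mul_su2Quat, show -(-β * w) = β * w by ring]
  exact mul_le_mul_of_nonneg_left (le_stapleTrace hsf) hβw

/-- … and `Re(wilsonDatum (−β) w u b · su2Quat g) ≤ β·w·N_b` always. [folklore] -/
theorem wilson_aligned_le {β w : ℝ} (hβw : 0 ≤ β * w) (u : GaugeField P j SU2) (b : PBond P j) (g : SU2) :
    (wilsonDatum (-β) w u b * su2Quat g).re ≤ β * w * (letterCount b : ℝ) := by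
  rw [re_wilsonDatum_mul_su2Quat, show -(-β * w) = β * w by ring]
  exact mul_le_mul_of_nonneg_left (stapleTrace_le _ _) hβw

/-- **TRANSVERSE PART**: under the same small-field condition with `0 ≤ ε ≤ 1`,
`‖a‖² − Re(a · su2Quat g)² ≤ (β·w·N_b·√(2ε))²` for `a = wilsonDatum (−β) w u b`. [folklore] -/
theorem wilson_transverse_le {β w ε : ℝ} (hβw : 0 ≤ β * w) (hε0 : 0 ≤ ε) (hε1 : ε ≤ 1) {u : GaugeField P j SU2}
    {b : PBond P j} {g : SU2} (hsf : ∀ p, IsLetter b p → 1 - ε ≤ reTr (GaugeField.plaqHol (Function.update u b g) p)) :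
    ‖wilsonDatum (-β) w u b‖ ^ 2 - (wilsonDatum (-β) w u b * su2Quat g).re ^ 2 ≤
      (β * w * (letterCount b : ℝ) * Real.sqrt (2 * ε)) ^ 2 := by
  have hA := wilson_aligned_ge hβw hsf
  have hN : ‖wilsonDatum (-β) w u b‖ ≤ β * w * (letterCount b : ℝ) := by
    have h := norm_wilsonDatum_le (-β) w u b
    rwa [show |(-β) * w| = β * w by rw [neg_mul, abs_neg, abs_of_nonneg hβw]] at h
  have hM : 0 ≤ β * w * (letterCount b : ℝ) := mul_nonneg hβw (Nat.cast_nonneg _)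
  have hA0 : 0 ≤ β * w * ((letterCount b : ℝ) * (1 - ε)) :=
    mul_nonneg hβw (mul_nonneg (Nat.cast_nonneg _) (by linarith))
  rw [mul_pow, Real.sq_sqrt (by linarith)]
  have h1 : ‖wilsonDatum (-β) w u b‖ ^ 2 ≤ (β * w * (letterCount b : ℝ)) ^ 2 :=
    pow_le_pow_left₀ (norm_nonneg _) hN 2
  have h2 : (β * w * ((letterCount b : ℝ) * (1 - ε))) ^ 2 ≤ (wilsonDatum (-β) w u b * su2Quat g).re ^ 2 :=
    pow_le_pow_left₀ hA0 hA 2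
  nlinarith [h1, h2, hM, mul_nonneg hM hε0, sq_nonneg ε]

end Datum

/-! ## §5  The datum is Lipschitz in the staple links -/

section Lipschitz

variable [DecidableEq (PBond P j)]

/-- `‖plaqDatum u b p − plaqDatum u' b p‖ ≤ 3δ` when every link quaternion of `u` is within `δ` of that of `u'`.
[folklore] -/
theorem norm_plaqDatum_sub_le {u u' : GaugeField P j SU2} {δ : ℝ}
    (hδ : ∀ b' : PBond P j, ‖su2Quat (u b') - su2Quat (u' b')‖ ≤ δ) (b : PBond P j) (p : Plaq P j) :
    ‖plaqDatum u b p - plaqDatum u' b p‖ ≤ 3 * δ := by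
  have hδ0 : 0 ≤ δ := (norm_nonneg _).trans (hδ b)
  have n1 : ∀ V : SU2, ‖su2Quat V‖ = 1 := norm_su2Quat
  unfold plaqDatum
  split_ifs
  · rw [su2Quat_mul, su2Quat_mul, su2Quat_mul, su2Quat_mul]
    refine (norm_mul₃_sub_le_of_norm_eq_one (n1 _) (n1 _) (n1 _) (n1 _)).trans ?_
    rw [norm_su2Quat_inv_sub, norm_su2Quat_inv_sub]
    linarith [hδ (bond₂ p), hδ (bond₃ p), hδ (bond₄ p)]
  · rw [su2Quat_mul, su2Quat_mul]
    refine (norm_mul₃_sub_le_of_norm_eq_one (n1 _) (n1 _) (n1 _) (n1 _)).trans ?_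
    rw [norm_su2Quat_inv_sub, norm_su2Quat_inv_sub]
    linarith [hδ (bond₁ p), hδ (bond₃ p), hδ (bond₄ p)]
  · rw [← star_sub, Quaternion.norm_star, su2Quat_mul, su2Quat_mul, ← mul_assoc, ← mul_assoc]
    refine (norm_mul₃_sub_le_of_norm_eq_one (n1 _) (n1 _) (n1 _) (n1 _)).trans ?_
    rw [norm_su2Quat_inv_sub]
    linarith [hδ (bond₁ p), hδ (bond₂ p), hδ (bond₄ p)]
  · rw [← star_sub, Quaternion.norm_star, su2Quat_mul, su2Quat_mul, su2Quat_mul, su2Quat_mul]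
    refine (norm_mul₃_sub_le_of_norm_eq_one (n1 _) (n1 _) (n1 _) (n1 _)).trans ?_
    rw [norm_su2Quat_inv_sub]
    linarith [hδ (bond₁ p), hδ (bond₂ p), hδ (bond₃ p)]
  · rw [sub_zero, norm_zero]
    linarith

/-- Hence `‖wilsonDatum c w u b − wilsonDatum c w u' b‖ ≤ |c·w| · N_b · 3δ`. [folklore] -/
theorem norm_wilsonDatum_sub_le (c w : ℝ) {u u' : GaugeField P j SU2} {δ : ℝ}
    (hδ : ∀ b' : PBond P j, ‖su2Quat (u b') - su2Quat (u' b')‖ ≤ δ) (b : PBond P j) :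
    ‖wilsonDatum c w u b - wilsonDatum c w u' b‖ ≤ |c * w| * (letterCount b : ℝ) * (3 * δ) := by
  have hδ0 : 0 ≤ δ := (norm_nonneg _).trans (hδ b)
  unfold wilsonDatum
  rw [← Finset.sum_sub_distrib]
  refine (norm_sum_le _ _).trans ?_
  have h : ∀ p : Plaq P j, ‖(-(c * w)) • plaqDatum u b p - (-(c * w)) • plaqDatum u' b p‖ ≤
      |c * w| * (3 * δ) * (if IsLetter b p then 1 else 0) := by
    intro p
    rw [← smul_sub, norm_smul, Real.norm_eq_abs, abs_neg]
    by_cases hL : IsLetter b p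
    · rw [if_pos hL, mul_one]
      exact mul_le_mul_of_nonneg_left (norm_plaqDatum_sub_le hδ b p) (abs_nonneg _)
    · rw [if_neg hL, mul_zero, plaqDatum_of_not_isLetter hL, plaqDatum_of_not_isLetter hL, sub_zero, norm_zero,
        mul_zero]
  refine (Finset.sum_le_sum fun p _ => h p).trans (le_of_eq ?_)
  rw [← Finset.mul_sum, Finset.sum_boole, letterCount]
  ring

end Lipschitz

/-! ## §6  THE WILSON SMALL-FIELD COROLLARY of the one-link gnomonic plug -/

section Plug

variable [DecidableEq (PBond P j)] {b : PBond P j} {n : ℕ} {u₀ : GaugeField P j SU2} {S : ℝ}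

open T4CovarianceResponse (respDom)

/-- `N_b = 2(d − 1)` as a real number. [folklore] -/
theorem letterCount_cast (b : PBond P j) : (letterCount b : ℝ) = 2 * ((P.d : ℝ) - 1) := by
  rw [letterCount_eq, Nat.cast_mul, Nat.cast_ofNat, Nat.cast_sub P.hd, Nat.cast_one]

/-- **THE WILSON SMALL-FIELD COROLLARY.**  `T4GnomonicWilsonHessian.mem_respDom_of_gnoChart_linkAffine'` for the
Gibbs exponent `h = fun U => −β * wilsonAction w U` of the cell's Wilson action through the one-link fibre `{b}`:
the affine binders are supplied by `T4WilsonLinkAffine.linkAffine_wilsonAction`, and the NUMERIC binders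
`hA₀ hA₁ hb₀ hB₀ hB₁ hmu₀ hmu₁ hgapN` are REPLACED by scalar hypotheses on the frozen plaquettes and links:
`reTr ≥ 1 − ε` on the `N = 2(d−1)` plaquettes through `b` of `u₀` and of `u with u(b) := u₀(b)`, link closeness `δ`,
one modulus inequality and the budget `β·w·N·3δ·(1+ρ+ρ²) ≤ b_H·dev u`.  The measurability / integrability / insert
binders and the conclusion are the plug's, verbatim. [folklore] -/
theorem mem_respDom_of_wilson_smallField {ι : Type*} (e : ↥({b} : Finset (PBond P j)) × Fin 3 ≃ Fin n)
    (hS : 0 < S) {S' : ℝ} (hSS' : S < S') (hS'1 : S' ≤ 1) {β w : ℝ} (hβ : 0 ≤ β) (hw : 0 ≤ w)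
    (hhm : Measurable fun U : GaugeField P j SU2 => -β * wilsonAction w U) {C : ℝ}
    (hC : ∀ U, windowDensity {b} u₀ S U * Real.exp (-β * wilsonAction w U) ≤ C) {u : GaugeField P j SU2} {K : ℝ}
    (hK : ∀ y : ↥({b} : Finset (PBond P j)) → SU2,
      |(-β * wilsonAction w (updateFinset u₀ {b} y)) - (-β * wilsonAction w (updateFinset u {b} y))| ≤ K)
    {dev : GaugeField P j SU2 → ℝ} (hdev : 0 ≤ dev u) {ε : ℝ} (hε0 : 0 ≤ ε) (hε1 : ε ≤ 1)
    (hsf₀ : ∀ p, IsLetter b p → 1 - ε ≤ reTr (GaugeField.plaqHol u₀ p))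
    (hsf₁ : ∀ p, IsLetter b p → 1 - ε ≤ reTr (GaugeField.plaqHol (Function.update u b (u₀ b)) p))
    {δ : ℝ} (hδ : ∀ b' : PBond P j, ‖su2Quat (u b') - su2Quat (u₀ b')‖ ≤ δ)
    {ρ : ℝ} (hρ : 0 ≤ ρ) (hρ2 : 2 * ρ ^ 2 ≤ 1) (hnS : (n : ℝ) * S' ^ 2 ≤ ρ ^ 2) {mu : ℝ}
    (hmu : mu ≤ gnoMu (β * w * (2 * ((P.d : ℝ) - 1)) * (1 - ε))
      (β * w * (2 * ((P.d : ℝ) - 1)) * Real.sqrt (2 * ε)) ρ)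
    (hlam : 0 < gnoKappa S' + mu) {bH : ℝ}
    (hgapN : β * w * (2 * ((P.d : ℝ) - 1)) * (3 * δ) * (1 + ρ + ρ ^ 2) ≤ bH * dev u)
    {B : (↥({b} : Finset (PBond P j)) → SU2) → ι → ℝ} {T : Finset ι} (hBm : ∀ i ∈ T, Measurable fun y => B y i)
    {L : ℝ}
    (hBg : ∀ i ∈ T, ∃ g : (Fin n → ℝ) → ℝ, ContDiff ℝ 1 g ∧
      (∀ x ∈ cube n S, g x = B (gnoFibreChart {b} u₀ e x) i) ∧
      ∀ x ∈ cube n S, coordGradient g x ⬝ᵥ coordGradient g x ≤ L ^ 2) :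
    u ∈ respDom {b} (windowDensity {b} u₀ S) (fun U => -β * wilsonAction w U) u₀ B T dev
      (bH / Real.sqrt (gnoKappa S' + mu)) (L / Real.sqrt (gnoKappa S' + mu)) := by
  have hβw : 0 ≤ β * w := mul_nonneg hβ hw
  have hNc := letterCount_cast b
  -- the aligned parts
  have hA₀' : β * w * ((letterCount b : ℝ) * (1 - ε)) ≤ (wilsonDatum (-β) w u₀ b * su2Quat (u₀ b)).re :=
    wilson_aligned_ge hβw (g := u₀ b) (by rw [Function.update_eq_self]; exact hsf₀)
  have hA₁' : β * w * ((letterCount b : ℝ) * (1 - ε)) ≤ (wilsonDatum (-β) w u b * su2Quat (u₀ b)).re :=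
    wilson_aligned_ge hβw hsf₁
  have hA0 : 0 ≤ β * w * ((letterCount b : ℝ) * (1 - ε)) :=
    mul_nonneg hβw (mul_nonneg (Nat.cast_nonneg _) (by linarith))
  -- the transverse parts
  have hB₀ := wilson_transverse_le hβw hε0 hε1 (g := u₀ b) (u := u₀) (b := b)
    (by rw [Function.update_eq_self]; exact hsf₀)
  have hB₁ := wilson_transverse_le hβw hε0 hε1 hsf₁
  have hb₀ : 0 ≤ β * w * (letterCount b : ℝ) * Real.sqrt (2 * ε) :=
    mul_nonneg (mul_nonneg hβw (Nat.cast_nonneg _)) (Real.sqrt_nonneg _)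
  -- the modulus
  rw [← hNc, show β * w * (letterCount b : ℝ) * (1 - ε) = β * w * ((letterCount b : ℝ) * (1 - ε)) by ring] at hmu
  have hmu₀ : mu ≤ gnoMu (wilsonDatum (-β) w u₀ b * su2Quat (u₀ b)).re
      (β * w * (letterCount b : ℝ) * Real.sqrt (2 * ε)) ρ := hmu.trans (gnoMu_mono_left hA₀' hρ2)
  have hmu₁ : mu ≤ gnoMu (wilsonDatum (-β) w u b * su2Quat (u₀ b)).re
      (β * w * (letterCount b : ℝ) * Real.sqrt (2 * ε)) ρ := hmu.trans (gnoMu_mono_left hA₁' hρ2)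
  -- the datum gap
  have hgap : ‖wilsonDatum (-β) w u b - wilsonDatum (-β) w u₀ b‖ * (1 + ρ + ρ ^ 2) ≤ bH * dev u := by
    have h := norm_wilsonDatum_sub_le (-β) w hδ b
    rw [show |(-β) * w| = β * w by rw [neg_mul, abs_neg, abs_of_nonneg hβw], hNc] at h
    exact (mul_le_mul_of_nonneg_right h (by positivity)).trans hgapN
  exact mem_respDom_of_gnoChart_linkAffine' e hS hSS' hS'1 hhm hC hK hdev (linkAffine_wilsonAction (-β) w u₀ b)
    (linkAffine_wilsonAction (-β) w u b) (hA0.trans hA₀') (hA0.trans hA₁') hb₀ hB₀ hB₁ hρ hρ2 hnS hmu₀ hmu₁ hlam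
    hgap hBm hBg

/-- NON-VACUITY of the scalar side at the flat base field and a flat perturbation: with `u₀ = u = 1`, `ε = δ = 0`,
`ρ = 0` the modulus inequality asks `mu ≤ 2(d−1)·β·w` and `κ(S') + mu > 0` holds for `mu = 2(d−1)βw ≥ 0`
(`gnoKappa S' > 0` is the window's own Poincaré constant — here only `gnoMu … 0 = A` is checked). [folklore] -/
example {β w : ℝ} : gnoMu (β * w * (2 * ((P.d : ℝ) - 1)) * (1 - 0)) (β * w * (2 * ((P.d : ℝ) - 1)) * Real.sqrt (2 * 0)) 0
    = β * w * (2 * ((P.d : ℝ) - 1)) := by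
  rw [T4GnomonicWilsonHessian.gnoMu_zero]; ring

end Plug

end Literature.MathematicalPhysics.QuantumFieldTheory.Balaban1983to89.T4WilsonDatumBounds

end
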